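import Summits.NavierStokesRegularity.NavierStokesRegularity.Theorems.ScenarioCensusRowF5lgGate
import HarnessLib

/-!
# Census rows F5lg / F5r (ns-idea-4 LINE «log-gate») — part 2/5: slice calculus of `x ↦ φ(cylRadius x)` off the axis; `x₀v₀ + x₁v₁ = r·u_r`

Part of the five-file re-homing (typer seat ns-census-typer-1 g5) of ns-idea-4 g10's LINE «log-gate» v1.1 (sha16 136999c2b89a0c68);
provenance and the file map are in `ScenarioCensusRowF5lgGate`.  Lean text verbatim in namespace `…Theorems.ScenarioCensus.LogGate`.
No census value is asserted here; NS regularity is NOT proved; no summit statement is proved by this file.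
-/

noncomputable section
set_option linter.dupNamespace false

open Literature.Analysis.FluidPDE MeasureTheory Set Filter Topology
open scoped ENNReal NNReal RealInnerProductSpace

namespace Summit.NavierStokesRegularity.NavierStokesRegularity.Theorems.ScenarioCensus.LogGate

open Summit.NavierStokesRegularity.NavierStokesRegularity.Theorems
open Summit.NavierStokesRegularity.NavierStokesRegularity.Theorems.ScenarioCensus

section SliceCalcSec

open Metric Function InnerProductSpace
open scoped Laplacian ContDiff

/-! ## §2b Slice calculus of `x ↦ φ(cylRadius x)` off the axis (PROVED; ported from kappa-inflow `SliceCalc`, ns-idea-4 g9,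
with the domain `(0,2)` generalised to `(0,b)`) -/

/-! Local first/second-order calculus of cylindrical functions `g(ρ)`, `ρ = x₀² + x₁²`, and of `φ(cylRadius x)` for `φ`
of class `C²` on `(0,b)`: `ContDiffAt ℝ 2` at off-axis points, the differential `φ′(r) r⁻¹ (z₀a₀ + z₁a₁)` and the
Laplacian `φ″ + φ′/r` — exactly what `weak_max_principle_of_contDiffAt` consumes. [folklore calculus] -/
namespace SliceCalc

/-- The differential of `y ↦ cylRadius y ^ 2` at `z`: `h ↦ 2(z₀h₀ + z₁h₁)`. [folklore] -/
def hform (z : E3) : E3 →L[ℝ] ℝ :=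
  (2 * z 0) • (EuclideanSpace.proj (0 : Fin 3) : E3 →L[ℝ] ℝ) +
    (2 * z 1) • (EuclideanSpace.proj (1 : Fin 3) : E3 →L[ℝ] ℝ)

/-- Unfolding `hform`. [folklore] -/
theorem hform_apply (z h : E3) : hform z h = 2 * (z 0 * h 0 + z 1 * h 1) := by
  simp only [hform, _root_.add_apply, _root_.smul_apply,
    smul_eq_mul, PiLp.proj_apply]
  ring

/-- `hform` is symmetric in its two arguments. [folklore] -/
theorem hform_comm (z h : E3) : hform z h = hform h z := by
  rw [hform_apply, hform_apply]; ring

/-- `D(cylRadius²)(z) = hform z`. [folklore] -/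
theorem hasFDerivAt_cylSq (z : E3) : HasFDerivAt (fun y : E3 => cylRadius y ^ 2) (hform z) z :=
  hasFDerivAt_cylRadius_sq z

/-- Chain rule for `g ∘ cylRadius²`. [folklore] -/
theorem hasFDerivAt_comp_cylSq {g : ℝ → ℝ} {g₁ : ℝ} {z : E3} (hg : HasDerivAt g g₁ (cylRadius z ^ 2)) :
    HasFDerivAt (fun w : E3 => g (cylRadius w ^ 2)) (g₁ • hform z) z :=
  hg.comp_hasFDerivAt z (hasFDerivAt_cylSq z)

/-- Chain rule for `g ∘ cylRadius²`, applied form. [folklore] -/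
theorem fderiv_comp_cylSq_apply {g : ℝ → ℝ} {g₁ : ℝ} {z : E3} (hg : HasDerivAt g g₁ (cylRadius z ^ 2)) (a : E3) :
    fderiv ℝ (fun w : E3 => g (cylRadius w ^ 2)) z a = g₁ * hform z a := by
  rw [(hasFDerivAt_comp_cylSq hg).fderiv]; simp

/-- Preimages of open sets under `cylRadius²` are neighbourhoods. [folklore] -/
theorem cylSq_preimage_mem_nhds {U : Set ℝ} (hU : IsOpen U) {z : E3} (hz : cylRadius z ^ 2 ∈ U) :
    {w : E3 | cylRadius w ^ 2 ∈ U} ∈ 𝓝 z := by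
  have hc : Continuous fun w : E3 => cylRadius w ^ 2 := by
    have : (fun w : E3 => cylRadius w ^ 2) = fun w => w 0 ^ 2 + w 1 ^ 2 := funext fun w => cylRadius_sq w
    rw [this]; fun_prop
  exact (hU.preimage hc).mem_nhds hz

/-- Second chain rule for `g ∘ cylRadius²`, applied to a fixed vector. [folklore] -/
theorem hasFDerivAt_fderiv_comp_cylSq_apply {g g₁ : ℝ → ℝ} {g₂ : ℝ} {U : Set ℝ} (hU : IsOpen U)
    (hg : ∀ σ ∈ U, HasDerivAt g (g₁ σ) σ) {z : E3} (hz : cylRadius z ^ 2 ∈ U)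
    (hg₁ : HasDerivAt g₁ g₂ (cylRadius z ^ 2)) (a : E3) :
    HasFDerivAt (fun w : E3 => fderiv ℝ (fun w : E3 => g (cylRadius w ^ 2)) w a)
      ((g₂ * hform z a) • hform z + (g₁ (cylRadius z ^ 2)) • hform a) z := by
  have heq : (fun w : E3 => g₁ (cylRadius w ^ 2) * hform a w) =ᶠ[𝓝 z]
      fun w => fderiv ℝ (fun w : E3 => g (cylRadius w ^ 2)) w a := by
    filter_upwards [cylSq_preimage_mem_nhds hU hz] with w hw
    rw [fderiv_comp_cylSq_apply (hg _ hw) a, hform_comm]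
  refine HasFDerivAt.congr_of_eventuallyEq ?_ heq.symm
  have h1 : HasFDerivAt (fun w : E3 => g₁ (cylRadius w ^ 2)) (g₂ • hform z) z := hasFDerivAt_comp_cylSq hg₁
  have h2 : HasFDerivAt (fun w : E3 => hform a w) (hform a) z := (hform a).hasFDerivAt
  refine (h1.mul h2).congr_fderiv ?_
  ext v
  simp only [_root_.add_apply, _root_.smul_apply, smul_eq_mul,
    hform_comm a z]
  ring

/-- Second derivative of `g ∘ cylRadius²`, applied form. [folklore] -/
theorem fderiv_fderiv_comp_cylSq_apply {g g₁ : ℝ → ℝ} {g₂ : ℝ} {U : Set ℝ} (hU : IsOpen U)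
    (hg : ∀ σ ∈ U, HasDerivAt g (g₁ σ) σ) {z : E3} (hz : cylRadius z ^ 2 ∈ U)
    (hg₁ : HasDerivAt g₁ g₂ (cylRadius z ^ 2)) (a c : E3) :
    fderiv ℝ (fun w : E3 => fderiv ℝ (fun w : E3 => g (cylRadius w ^ 2)) w a) z c =
      g₂ * hform z a * hform z c + g₁ (cylRadius z ^ 2) * hform a c := by
  rw [(hasFDerivAt_fderiv_comp_cylSq_apply hU hg hz hg₁ a).fderiv]
  simp only [_root_.add_apply, _root_.smul_apply, smul_eq_mul]

/-- `y ↦ D(g ∘ cylRadius²)(y) a` is differentiable. [folklore] -/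
theorem differentiableAt_fderiv_comp_cylSq {g g₁ : ℝ → ℝ} {g₂ : ℝ} {U : Set ℝ} (hU : IsOpen U)
    (hg : ∀ σ ∈ U, HasDerivAt g (g₁ σ) σ) {z : E3} (hz : cylRadius z ^ 2 ∈ U)
    (hg₁ : HasDerivAt g₁ g₂ (cylRadius z ^ 2)) :
    DifferentiableAt ℝ (fderiv ℝ (fun w : E3 => g (cylRadius w ^ 2))) z := by
  have heq : (fun w : E3 => (g₁ (cylRadius w ^ 2)) • hform w) =ᶠ[𝓝 z]
      fderiv ℝ (fun w : E3 => g (cylRadius w ^ 2)) := by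
    filter_upwards [cylSq_preimage_mem_nhds hU hz] with w hw
    exact ((hasFDerivAt_comp_cylSq (hg _ hw)).fderiv).symm
  refine DifferentiableAt.congr_of_eventuallyEq ?_ heq.symm
  have h1 : DifferentiableAt ℝ (fun w : E3 => g₁ (cylRadius w ^ 2)) z :=
    (hasFDerivAt_comp_cylSq hg₁).differentiableAt
  have h2 : DifferentiableAt ℝ (fun w : E3 => hform w) z := by
    have hP0 : DifferentiableAt ℝ (fun w : E3 => (2 * w 0) • (EuclideanSpace.proj (0 : Fin 3) : E3 →L[ℝ] ℝ)) z :=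
      ((differentiableAt_const _).mul ((EuclideanSpace.proj (0 : Fin 3) : E3 →L[ℝ] ℝ).differentiableAt)).smul_const _
    have hP1 : DifferentiableAt ℝ (fun w : E3 => (2 * w 1) • (EuclideanSpace.proj (1 : Fin 3) : E3 →L[ℝ] ℝ)) z :=
      ((differentiableAt_const _).mul ((EuclideanSpace.proj (1 : Fin 3) : E3 →L[ℝ] ℝ).differentiableAt)).smul_const _
    exact hP0.add hP1
  exact h1.smul h2

/-- Laplacian of `g ∘ cylRadius²`: `4ρ g″(ρ) + 4 g′(ρ)`. [folklore] -/
theorem laplacian_comp_cylSq {g g₁ : ℝ → ℝ} {g₂ : ℝ} {U : Set ℝ} (hU : IsOpen U)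
    (hg : ∀ σ ∈ U, HasDerivAt g (g₁ σ) σ) {z : E3} (hz : cylRadius z ^ 2 ∈ U)
    (hg₁ : HasDerivAt g₁ g₂ (cylRadius z ^ 2)) :
    (Δ (fun w : E3 => g (cylRadius w ^ 2))) z = 4 * g₂ * cylRadius z ^ 2 + 4 * g₁ (cylRadius z ^ 2) := by
  classical
  set b := EuclideanSpace.basisFun (Fin 3) ℝ with hb
  have hb' : ∀ i, b i = EuclideanSpace.single i 1 := fun i => by simp [hb]
  have hD := differentiableAt_fderiv_comp_cylSq hU hg hz hg₁
  have h1 : ∀ i, iteratedFDeriv ℝ 2 (fun w : E3 => g (cylRadius w ^ 2)) z ![b i, b i] =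
      g₂ * hform z (b i) * hform z (b i) + g₁ (cylRadius z ^ 2) * hform (b i) (b i) := fun i => by
    rw [iteratedFDeriv_two_apply, ← fderiv_fderiv_comp_cylSq_apply hU hg hz hg₁ (b i) (b i),
      fderiv_clm_apply hD (differentiableAt_const _)]
    simp
  rw [congrFun (laplacian_eq_iteratedFDeriv_orthonormalBasis (fun w : E3 => g (cylRadius w ^ 2)) b) z]
  simp_rw [h1]
  simp only [Fin.sum_univ_three, hb', hform_apply, PiLp.single_apply]
  simp
  rw [cylRadius_sq]
  ring

/-- Pointwise first and second derivatives of a function `C²` on `(0,b)`. -/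
theorem slice_derivs {φ : ℝ → ℝ} {b : ℝ} (hφ : ContDiffOn ℝ 2 φ (Ioo 0 b)) {r : ℝ} (hr : r ∈ Ioo (0 : ℝ) b) :
    HasDerivAt φ (deriv φ r) r ∧ HasDerivAt (deriv φ) (iteratedDeriv 2 φ r) r := by
  have hO : IsOpen (Ioo (0 : ℝ) b) := isOpen_Ioo
  have h := (contDiffOn_succ_iff_deriv_of_isOpen (n := 1) hO).1 (by rw [one_add_one_eq_two]; exact hφ)
  obtain ⟨hd, _, hd'⟩ := h
  refine ⟨(hd.differentiableAt (hO.mem_nhds hr)).hasDerivAt, ?_⟩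
  have hdd : DifferentiableOn ℝ (deriv φ) (Ioo 0 b) := hd'.differentiableOn one_ne_zero
  have h2 : HasDerivAt (deriv φ) (deriv (deriv φ) r) r :=
    (hdd.differentiableAt (hO.mem_nhds hr)).hasDerivAt
  rwa [show (2 : ℕ) = 1 + 1 from rfl, iteratedDeriv_succ, iteratedDeriv_one]

/-- **Slice calculus of a cylindrical barrier off the axis** (domain `(0,b)`). -/
theorem barrier_slice_calculus {φ : ℝ → ℝ} {b : ℝ} (hφ : ContDiffOn ℝ 2 φ (Ioo 0 b)) {z : E3}
    (hz : 0 < cylRadius z) (hz2 : cylRadius z < b) :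
    ContDiffAt ℝ 2 (fun w : E3 => φ (cylRadius w)) z ∧
    (∀ a : E3, fderiv ℝ (fun w : E3 => φ (cylRadius w)) z a =
        deriv φ (cylRadius z) * (cylRadius z)⁻¹ * (z 0 * a 0 + z 1 * a 1)) ∧
    (Δ (fun w : E3 => φ (cylRadius w))) z =
        iteratedDeriv 2 φ (cylRadius z) + (cylRadius z)⁻¹ * deriv φ (cylRadius z) := by
  set r := cylRadius z with hr
  have hb : 0 < b := hz.trans hz2
  have hrI : r ∈ Ioo (0 : ℝ) b := ⟨hz, hz2⟩
  set g : ℝ → ℝ := fun s => φ (Real.sqrt s) with hg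
  have hfun : (fun w : E3 => φ (cylRadius w)) = fun w => g (cylRadius w ^ 2) := by
    funext w; simp only [hg, Real.sqrt_sq (cylRadius_nonneg w)]
  set U : Set ℝ := Ioo 0 (b ^ 2) with hU
  have hUo : IsOpen U := isOpen_Ioo
  have hsqU : ∀ σ ∈ U, Real.sqrt σ ∈ Ioo (0 : ℝ) b := fun σ hσ => by
    refine ⟨Real.sqrt_pos.2 hσ.1, ?_⟩
    rw [show b = Real.sqrt (b ^ 2) by rw [Real.sqrt_sq hb.le]]
    exact Real.sqrt_lt_sqrt hσ.1.le hσ.2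
  set g₁ : ℝ → ℝ := fun σ => deriv φ (Real.sqrt σ) / (2 * Real.sqrt σ) with hg₁
  have hgd : ∀ σ ∈ U, HasDerivAt g (g₁ σ) σ := fun σ hσ => by
    have h1 := (slice_derivs hφ (hsqU σ hσ)).1
    have h2 := Real.hasDerivAt_sqrt hσ.1.ne'
    refine (h1.comp σ h2).congr_deriv ?_
    rw [hg₁]
    ring
  have hzU : cylRadius z ^ 2 ∈ U := by
    refine ⟨by positivity, ?_⟩
    rw [← hr]; nlinarith [hz, hz2]
  have hsr : Real.sqrt (r ^ 2) = r := Real.sqrt_sq hz.le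
  have hg₁d : HasDerivAt g₁
      ((iteratedDeriv 2 φ r * (1 / (2 * r)) * (2 * r) - deriv φ r * (2 * (1 / (2 * r)))) / (2 * r) ^ 2)
      (cylRadius z ^ 2) := by
    rw [← hr]
    have hσ0 : (r ^ 2 : ℝ) ≠ 0 := by positivity
    have hs := Real.hasDerivAt_sqrt hσ0
    rw [hsr] at hs
    have d1 : HasDerivAt (fun σ => deriv φ (Real.sqrt σ)) (iteratedDeriv 2 φ r * (1 / (2 * r))) (r ^ 2) := by
      have h := (slice_derivs hφ hrI).2
      have h' : HasDerivAt (deriv φ) (iteratedDeriv 2 φ r) (Real.sqrt (r ^ 2)) := by rwa [hsr]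
      exact h'.comp (r ^ 2) hs
    have d2 : HasDerivAt (fun σ => 2 * Real.sqrt σ) (2 * (1 / (2 * r))) (r ^ 2) := hs.const_mul 2
    have hne : (2 * Real.sqrt (r ^ 2)) ≠ 0 := by rw [hsr]; positivity
    refine (d1.div d2 hne).congr_deriv ?_
    rw [hsr]
  refine ⟨?_, fun a => ?_, ?_⟩
  · exact (hφ.contDiffAt (isOpen_Ioo.mem_nhds hrI)).comp z (contDiffAt_cylRadius hz.ne')
  · rw [hfun, fderiv_comp_cylSq_apply (hgd _ hzU) a, hform_apply, hg₁]
    simp only [← hr, hsr]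
    field_simp
  · rw [hfun, laplacian_comp_cylSq hUo hgd hzU hg₁d, hg₁]
    simp only [← hr, hsr]
    field_simp
    ring

end SliceCalc

end SliceCalcSec

section HorizSec

open Metric Function InnerProductSpace
open scoped Laplacian ContDiff

/-- `x₀v₀ + x₁v₁ = r · u_r` off the axis. [folklore] -/
theorem horiz_eq_mul_radialVelocity (v : E3 → E3) {x : E3} (hx : cylRadius x ≠ 0) :
    x 0 * v x 0 + x 1 * v x 1 = cylRadius x * radialVelocity v x := by
  rw [radialVelocity_eq_div', mul_div_cancel₀ _ hx]

/-- `x₀(e_r)₀ + x₁(e_r)₁ = r` off the axis. [folklore] -/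
theorem horiz_eR {x : E3} (hx : cylRadius x ≠ 0) :
    x 0 * eR x 0 + x 1 * eR x 1 = cylRadius x := by
  have h := horiz_eq_mul_radialVelocity (fun _ => eR x) hx
  have h1 : radialVelocity (fun _ => eR x) x = 1 := by
    rw [radialVelocity]
    exact inner_eR_self hx
  simpa [h1] using h

end HorizSec


end Summit.NavierStokesRegularity.NavierStokesRegularity.Theorems.ScenarioCensus.LogGate

end
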